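import Mathlib
import Summits.Ventures.HodgeRepro2.Hypothesis
import Summits.Ventures.HodgeRepro2.Level
import Summits.Ventures.HodgeRepro2.Neat
import Summits.Ventures.HodgeRepro2.NeatTorsionFree
import Summits.Ventures.HodgeRepro2.T5CongruentRootOfUnity
import Summits.Ventures.HodgeRepro2.CongruenceNeat

/-!
# LevelNeat — Shimura's level subgroup `Γ_N` (Sh79 (4.14)) is neat for `N > 2`

`Hypothesis.lean` (p2 file 1) defines the level group of the Tier-3 instantiation as Shimura's
`Γ_N = {γ ∈ SU(H) : 𝔪γ = 𝔪, x − xγ ∈ N𝔪 for all x ∈ 𝔪}` (`shimuraLevel K H 𝔪 N`, Sh79 (4.14))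
for a lattice `𝔪 ⊂ K^m` (`IsLattice`: finitely generated over `ℤ`, spanning over `ℚ`), and
`NonVanishingInput` quantifies over it. `CongruenceNeat.lean` proved DR15 Lemma 1.4 for the
principal congruence set `Γ(N)` of the matrix entries. This file proves the same for Shimura's
`Γ_N`: for `N > 2` it is neat, hence torsion-free (its arithmetic groups act freely).

The argument avoids characteristic polynomials over `ℚ`: for `γ ∈ Γ_N` and an eigenvalue `z` of
`τ(γ)` with eigenvector `w ∈ ℂ^m`, the `ℚ`-linear functional `φ(x) = τ(x) ⬝ w` on `K^m`
satisfies `φ(xγ) = z φ(x)`; on a `ℤ`-basis `v_1, …, v_r` of `𝔪` (`Module.Free` over the PID `ℤ`)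
the matrix `C` of `x ↦ xγ` has integer entries with `C ≡ 1 mod N`, and `(φ(v_i))_i` is a
non-zero eigenvector of `C` for `z` (`φ ≠ 0` on `𝔪` because `𝔪` spans `K^m` over `ℚ` and `w ≠ 0`).
So `z` is an eigenvalue of an integer matrix `≡ 1 mod N`: by `CongruenceNeat` it is an
algebraic integer `≡ 1 mod N·𝒪`; likewise `z⁻¹` from `γ⁻¹ ∈ Γ_N`; hence the eigenvalues lie in
the subgroup `congrUnits N`, whose roots of unity are `1` (`T5CongruentRootOfUnity`).

* `pairing`, `pairing_vecMul` — the functional `φ` and `φ(xγ) = τ(x) ⬝ (τ(γ) w)`;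
* `exists_mem_pairing_ne_zero` — `φ` does not vanish on a spanning lattice when `w ≠ 0`;
* `levelMatrix`, `vecMul_basis_eq_sum`, `levelMatrix_sub_one_eq` — the integer matrix of `γ` on
  a `ℤ`-basis of `𝔪` and its congruence `C − 1 = N·E`;
* `isCongrOne_of_mem_roots_charpoly_of_mem_shimuraLevel` — eigenvalues of `τ(γ)`, `γ ∈ Γ_N`,
  are algebraic integers `≡ 1 mod N`;
* `eigenvalueUnits_subset_congrUnits_of_mem_shimuraLevel`;
* **`isNeat_shimuraLevel`** — `Γ_N` is neat for `2 < N` and `𝔪` a lattice;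
* **`isTorsionFreeSet_shimuraLevel`** — `Γ_N` is torsion-free for `2 < N`.
-/

namespace Summit.Ventures.HodgeRepro2.ShimuraData

open Matrix

/-! ## §1 The pairing `φ(x) = τ(x) ⬝ w` -/

section Pairing

variable {K : Type*} [Field K] [NumberField K] {m : ℕ}

/-- The functional `x ↦ τ(x) ⬝ w` on `K^m`, as an additive map. -/
def pairing (τ : K →+* ℂ) (w : Fin m → ℂ) : (Fin m → K) →+ ℂ where
  toFun x := (τ ∘ x) ⬝ᵥ w
  map_zero' := by simp [dotProduct]
  map_add' x y := by
    simp only [dotProduct, Function.comp_apply, Pi.add_apply, map_add, add_mul, Finset.sum_add_distrib]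

/-- Unfolding lemma. -/
theorem pairing_apply (τ : K →+* ℂ) (w : Fin m → ℂ) (x : Fin m → K) :
    pairing τ w x = (τ ∘ x) ⬝ᵥ w := rfl

/-- `φ(xγ) = τ(x) ⬝ (τ(γ) w)`. -/
theorem pairing_vecMul (τ : K →+* ℂ) (w : Fin m → ℂ) (γ : Matrix (Fin m) (Fin m) K)
    (x : Fin m → K) : pairing τ w (vecMul x γ) = (τ ∘ x) ⬝ᵥ ((γ.map τ) *ᵥ w) := by
  rw [pairing_apply, dotProduct_mulVec]
  congr 1
  funext i
  exact RingHom.map_vecMul τ γ x i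

/-- For an eigenvector `w` of `τ(γ)`, `φ(xγ) = z φ(x)`. -/
theorem pairing_vecMul_eq_smul (τ : K →+* ℂ) {w : Fin m → ℂ} (γ : Matrix (Fin m) (Fin m) K)
    {z : ℂ} (hw : (γ.map τ) *ᵥ w = z • w) (x : Fin m → K) :
    pairing τ w (vecMul x γ) = z * pairing τ w x := by
  rw [pairing_vecMul, hw, dotProduct_smul, smul_eq_mul, pairing_apply]

/-- `φ` is `ℚ`-linear. -/
theorem pairing_rat_smul (τ : K →+* ℂ) (w : Fin m → ℂ) (q : ℚ) (x : Fin m → K) :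
    pairing τ w (q • x) = q • pairing τ w x := by
  simp only [pairing_apply, dotProduct, Function.comp_apply, Pi.smul_apply, Rat.smul_def,
    map_mul, map_ratCast, Finset.mul_sum, mul_assoc]

/-- The `ℚ`-linear map underlying `φ`. -/
def pairingₗ (τ : K →+* ℂ) (w : Fin m → ℂ) : (Fin m → K) →ₗ[ℚ] ℂ where
  toFun := pairing τ w
  map_add' := map_add _
  map_smul' := pairing_rat_smul τ w

/-- `φ(e_k) = w_k` for the standard basis vector `e_k`. -/
theorem pairing_single (τ : K →+* ℂ) (w : Fin m → ℂ) (k : Fin m) :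
    pairing τ w (Pi.single k 1) = w k := by
  simp [pairing_apply, dotProduct, Function.comp_apply, Pi.single_apply, apply_ite τ]

/-- If `φ` vanishes on a set spanning `K^m` over `ℚ`, then `w = 0`. -/
theorem eq_zero_of_forall_mem_pairing_eq_zero (τ : K →+* ℂ) (w : Fin m → ℂ)
    (S : Set (Fin m → K)) (hS : Submodule.span ℚ S = ⊤) (h : ∀ x ∈ S, pairing τ w x = 0) :
    w = 0 := by
  have hker : Submodule.span ℚ S ≤ LinearMap.ker (pairingₗ τ w) := by
    rw [Submodule.span_le]
    intro x hx
    exact h x hx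
  rw [hS] at hker
  funext k
  have := hker (Submodule.mem_top (x := Pi.single k 1))
  rw [LinearMap.mem_ker] at this
  have h2 : pairing τ w (Pi.single k 1) = 0 := this
  rw [pairing_single] at h2
  rw [h2, Pi.zero_apply]

/-- If `w ≠ 0` and `S` spans `K^m` over `ℚ`, some `x ∈ S` has `φ(x) ≠ 0`. -/
theorem exists_mem_pairing_ne_zero (τ : K →+* ℂ) {w : Fin m → ℂ} (hw : w ≠ 0)
    (S : Set (Fin m → K)) (hS : Submodule.span ℚ S = ⊤) : ∃ x ∈ S, pairing τ w x ≠ 0 := by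
  by_contra h
  push Not at h
  exact hw (eq_zero_of_forall_mem_pairing_eq_zero τ w S hS h)

end Pairing

/-! ## §2 The integer matrix of `γ` on a `ℤ`-basis of the lattice -/

section LatticeMatrix

variable {K : Type*} [Field K] [NumberField K] {m : ℕ}

/-- The integer matrix of `x ↦ xγ` on a `ℤ`-basis `b` of `𝔪` (for `γ` preserving `𝔪`). -/
noncomputable def levelMatrix {𝔪 : Submodule ℤ (Fin m → K)} {ι : Type*} (b : Module.Basis ι ℤ 𝔪)
    (γ : Matrix (Fin m) (Fin m) K) (hγ : ∀ x ∈ 𝔪, vecMul x γ ∈ 𝔪) : Matrix ι ι ℤ :=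
  fun i j => b.repr ⟨vecMul (b i : Fin m → K) γ, hγ _ (b i).2⟩ j

omit [NumberField K] in
/-- `v_i γ = ∑_j C_{ij} v_j` in `K^m`. -/
theorem vecMul_basis_eq_sum {𝔪 : Submodule ℤ (Fin m → K)} {ι : Type*} [Fintype ι]
    (b : Module.Basis ι ℤ 𝔪) (γ : Matrix (Fin m) (Fin m) K)
    (hγ : ∀ x ∈ 𝔪, vecMul x γ ∈ 𝔪) (i : ι) :
    vecMul (b i : Fin m → K) γ = ∑ j, (levelMatrix b γ hγ i j) • (b j : Fin m → K) := by
  have h := b.sum_repr ⟨vecMul (b i : Fin m → K) γ, hγ _ (b i).2⟩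
  have := congrArg (fun y : 𝔪 => (y : Fin m → K)) h
  simp only [Submodule.coe_sum, Submodule.coe_smul] at this
  rw [← this]
  rfl

omit [NumberField K] in
/-- The congruence `C − 1 = N·E` with `E` an integer matrix, from `x − xγ ∈ N𝔪`. -/
theorem levelMatrix_sub_one_eq {𝔪 : Submodule ℤ (Fin m → K)} {ι : Type*} [Fintype ι]
    [DecidableEq ι] (b : Module.Basis ι ℤ 𝔪) (γ : Matrix (Fin m) (Fin m) K)
    (hγ : ∀ x ∈ 𝔪, vecMul x γ ∈ 𝔪) {N : ℕ}
    (hcong : ∀ x ∈ 𝔪, ∃ y ∈ 𝔪, x - vecMul x γ = (N : ℤ) • y) :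
    ∃ E : Matrix ι ι ℤ, levelMatrix b γ hγ - 1 = (N : ℤ) • E := by
  choose y hy hxy using hcong
  refine ⟨fun i j => -(b.repr ⟨y _ (b i).2, hy _ (b i).2⟩ j), ?_⟩
  ext i j
  rw [Matrix.sub_apply, Matrix.one_apply, Matrix.smul_apply, smul_eq_mul, mul_neg]
  -- `b.repr (v_i γ) = b.repr v_i − N • b.repr y_i`
  have hvec : (⟨vecMul (b i : Fin m → K) γ, hγ _ (b i).2⟩ : 𝔪) =
      b i - (N : ℤ) • ⟨y _ (b i).2, hy _ (b i).2⟩ := by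
    apply Subtype.ext
    simp only [Submodule.coe_sub, Submodule.coe_smul]
    have := hxy _ (b i).2
    rw [eq_sub_iff_add_eq, add_comm]
    exact (sub_eq_iff_eq_add.mp this).symm
  unfold levelMatrix
  rw [hvec, map_sub, map_smul, Finsupp.sub_apply, Finsupp.smul_apply, b.repr_self,
    Finsupp.single_apply, smul_eq_mul]
  split_ifs <;> ring

end LatticeMatrix

/-! ## §3 Eigenvalues of `τ(γ)` for `γ ∈ Γ_N` -/

section Level

variable {K : Type*} [Field K] [NumberField K] {m : ℕ}

/-- Eigenvalues of a matrix with algebraic-integer entries are algebraic integers (any finite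
index type; the `Fin`-indexed form is `CongruenceNeat.isIntegral_of_mem_roots_charpoly`). -/
theorem isIntegral_of_mem_roots_charpoly' {ι : Type*} [Fintype ι] [DecidableEq ι]
    (A : Matrix ι ι ℂ) (hA : ∀ i j, IsIntegral ℤ (A i j)) {z : ℂ}
    (hz : z ∈ A.charpoly.roots) : IsIntegral ℤ z := by
  let S := integralClosure ℤ ℂ
  let A' : Matrix ι ι S := fun i j => ⟨A i j, hA i j⟩
  have hmap : A'.map (algebraMap S ℂ) = A := by
    ext i j; rfl
  have hroot : A.charpoly.IsRoot z := (Polynomial.mem_roots'.mp hz).2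
  have hS : IsIntegral S z := by
    refine ⟨A'.charpoly, charpoly_monic A', ?_⟩
    rw [Polynomial.eval₂_eq_eval_map, ← charpoly_map, hmap]
    exact hroot
  exact isIntegral_trans z hS

/-- An eigenvector gives a root of the characteristic polynomial (any finite index type). -/
theorem mem_roots_charpoly_of_mulVec_eq_smul' {ι : Type*} [Fintype ι] [DecidableEq ι]
    (A : Matrix ι ι ℂ) {z : ℂ} {v : ι → ℂ} (hv : v ≠ 0) (hAv : A *ᵥ v = z • v) :
    z ∈ A.charpoly.roots := by
  rw [Polynomial.mem_roots (charpoly_monic A).ne_zero, Polynomial.IsRoot.def, eval_charpoly]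
  rw [← exists_mulVec_eq_zero_iff]
  refine ⟨v, hv, ?_⟩
  rw [sub_mulVec, hAv, scalar_apply, sub_eq_zero]
  ext i
  rw [mulVec_diagonal, Pi.smul_apply, smul_eq_mul]

/-- If `A − 1 = N·B` and `A v = z v`, then `B v = ((z − 1)/N) • v` (any finite index type). -/
theorem mulVec_eq_smul_of_sub_one_eq' {ι : Type*} [Fintype ι] [DecidableEq ι]
    (A B : Matrix ι ι ℂ) {N : ℕ} (hN : N ≠ 0) (hAB : A - 1 = (N : ℂ) • B) {z : ℂ} {v : ι → ℂ}
    (hAv : A *ᵥ v = z • v) : B *ᵥ v = ((z - 1) / N) • v := by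
  have hN' : (N : ℂ) ≠ 0 := Nat.cast_ne_zero.mpr hN
  have h1 : (A - 1) *ᵥ v = (z - 1) • v := by
    rw [sub_mulVec, one_mulVec, hAv, sub_smul, one_smul]
  rw [hAB, smul_mulVec] at h1
  have h2 : B *ᵥ v = (N : ℂ)⁻¹ • ((N : ℂ) • B *ᵥ v) := by
    rw [smul_smul, inv_mul_cancel₀ hN', one_smul]
  rw [h2, h1, smul_smul, div_eq_inv_mul]

/-- An integer matrix read in `ℂ`. -/
def castℂ {ι : Type*} (C : Matrix ι ι ℤ) : Matrix ι ι ℂ := fun i j => (C i j : ℂ)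

/-- Unfolding lemma. -/
theorem castℂ_apply {ι : Type*} (C : Matrix ι ι ℤ) (i j : ι) : castℂ C i j = (C i j : ℂ) := rfl

/-- The entries of `castℂ C` are algebraic integers. -/
theorem isIntegral_castℂ {ι : Type*} (C : Matrix ι ι ℤ) (i j : ι) : IsIntegral ℤ (castℂ C i j) :=
  isIntegral_intCast (C i j)

/-- `C − 1 = N·E` in `ℤ` gives `castℂ C − 1 = N • castℂ E` in `ℂ`. -/
theorem castℂ_sub_one_eq {ι : Type*} [DecidableEq ι] {C E : Matrix ι ι ℤ} {N : ℕ}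
    (h : C - 1 = (N : ℤ) • E) : castℂ C - 1 = (N : ℂ) • castℂ E := by
  ext i j
  have h' := congrFun (congrFun h i) j
  rw [Matrix.sub_apply, Matrix.one_apply, Matrix.smul_apply, smul_eq_mul] at h'
  rw [Matrix.sub_apply, Matrix.one_apply, Matrix.smul_apply, smul_eq_mul, castℂ_apply, castℂ_apply]
  by_cases hij : i = j
  · simp only [hij, if_true] at h' ⊢
    exact_mod_cast h'
  · simp only [hij, if_false] at h' ⊢
    exact_mod_cast h'

/-- **The eigenvector of the integer matrix.** For `γ` preserving `𝔪` with `ℤ`-basis `b`, an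
eigenvector `w` of `τ(γ)` with eigenvalue `z`, the vector `Φ_i = φ(v_i)` satisfies
`castℂ C *ᵥ Φ = z • Φ`. -/
theorem castℂ_levelMatrix_mulVec {𝔪 : Submodule ℤ (Fin m → K)} {ι : Type*} [Fintype ι]
    (b : Module.Basis ι ℤ 𝔪) (τ : K →+* ℂ) (γ : Matrix (Fin m) (Fin m) K)
    (hγ : ∀ x ∈ 𝔪, vecMul x γ ∈ 𝔪) {w : Fin m → ℂ} {z : ℂ} (hw : (γ.map τ) *ᵥ w = z • w) :
    castℂ (levelMatrix b γ hγ) *ᵥ (fun i => pairing τ w (b i : Fin m → K)) =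
      z • (fun i => pairing τ w (b i : Fin m → K)) := by
  funext i
  have h1 := pairing_vecMul_eq_smul τ γ hw (b i : Fin m → K)
  rw [vecMul_basis_eq_sum b γ hγ i, map_sum] at h1
  simp only [map_zsmul] at h1
  simp only [zsmul_eq_mul] at h1
  show ∑ j, castℂ (levelMatrix b γ hγ) i j * pairing τ w (b j : Fin m → K) =
    z * pairing τ w (b i : Fin m → K)
  rw [← h1]
  rfl

/-- `Φ ≠ 0` when `w ≠ 0` and `𝔪` spans `K^m` over `ℚ`. -/
theorem pairing_basis_ne_zero {𝔪 : Submodule ℤ (Fin m → K)} {ι : Type*} [Fintype ι]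
    (b : Module.Basis ι ℤ 𝔪) (τ : K →+* ℂ) {w : Fin m → ℂ} (hw : w ≠ 0)
    (hspan : Submodule.span ℚ (𝔪 : Set (Fin m → K)) = ⊤) :
    (fun i => pairing τ w (b i : Fin m → K)) ≠ 0 := by
  intro h0
  apply hw
  apply eq_zero_of_forall_mem_pairing_eq_zero τ w (𝔪 : Set (Fin m → K)) hspan
  intro x hx
  have hx' := b.sum_repr ⟨x, hx⟩
  have hx'' : x = ∑ i, (b.repr ⟨x, hx⟩ i) • (b i : Fin m → K) := by
    have := congrArg (fun y : 𝔪 => (y : Fin m → K)) hx'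
    simp only [Submodule.coe_sum, Submodule.coe_smul] at this
    exact this.symm
  rw [hx'', map_sum]
  apply Finset.sum_eq_zero
  intro i _
  rw [map_zsmul]
  have : pairing τ w (b i : Fin m → K) = 0 := congrFun h0 i
  rw [this, smul_zero]

/-- **Eigenvalues of `τ(γ)` are algebraic integers `≡ 1 mod N`** when `γ` preserves a spanning
lattice `𝔪` with `ℤ`-basis `b` and `x − xγ ∈ N𝔪` on `𝔪`. -/
theorem isCongrOne_of_mem_roots_charpoly_of_lattice {𝔪 : Submodule ℤ (Fin m → K)}
    {ι : Type*} [Fintype ι] [DecidableEq ι] (b : Module.Basis ι ℤ 𝔪)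
    (hspan : Submodule.span ℚ (𝔪 : Set (Fin m → K)) = ⊤) (τ : K →+* ℂ)
    (γ : Matrix (Fin m) (Fin m) K) (hγ : ∀ x ∈ 𝔪, vecMul x γ ∈ 𝔪) {N : ℕ} (hN : N ≠ 0)
    (hcong : ∀ x ∈ 𝔪, ∃ y ∈ 𝔪, x - vecMul x γ = (N : ℤ) • y) {z : ℂ}
    (hz : z ∈ (γ.map τ).charpoly.roots) : IsCongrOne N z := by
  obtain ⟨w, hw, hw'⟩ := exists_mulVec_eq_smul_of_mem_roots _ hz
  obtain ⟨E, hE⟩ := levelMatrix_sub_one_eq b γ hγ hcong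
  have hCE := castℂ_sub_one_eq hE
  have hΦeig := castℂ_levelMatrix_mulVec b τ γ hγ hw'
  have hΦne := pairing_basis_ne_zero b τ hw hspan
  have hzC := mem_roots_charpoly_of_mulVec_eq_smul' _ hΦne hΦeig
  refine ⟨isIntegral_of_mem_roots_charpoly' _ (isIntegral_castℂ _) hzC, (z - 1) / N, ?_, ?_⟩
  · have hEΦ := mulVec_eq_smul_of_sub_one_eq' _ _ hN hCE hΦeig
    exact isIntegral_of_mem_roots_charpoly' _ (isIntegral_castℂ _)
      (mem_roots_charpoly_of_mulVec_eq_smul' _ hΦne hEΦ)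
  · rw [mul_div_cancel₀ _ (Nat.cast_ne_zero.mpr hN)]

variable [NumberField.IsCMField K]

omit [NumberField.IsCMField K] in
/-- A lattice is a free `ℤ`-module. -/
theorem isLattice_free {𝔪 : Submodule ℤ (Fin m → K)} (h𝔪 : IsLattice K 𝔪) :
    Module.Free ℤ 𝔪 := by
  haveI : Module.Finite ℤ 𝔪 := h𝔪.1
  exact Module.free_of_finite_type_torsion_free'

/-- Eigenvalues of `τ(γ)`, `γ ∈ Γ_N`, are algebraic integers `≡ 1 mod N`. -/
theorem isCongrOne_of_mem_roots_charpoly_of_mem_shimuraLevel (τ : K →+* ℂ)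
    (H : Matrix (Fin m) (Fin m) K) {𝔪 : Submodule ℤ (Fin m → K)} (h𝔪 : IsLattice K 𝔪)
    {N : ℕ} (hN : N ≠ 0) {γ : GL (Fin m) K} (hγ : γ ∈ shimuraLevel K H 𝔪 N) {z : ℂ}
    (hz : z ∈ ((γ : Matrix (Fin m) (Fin m) K).map τ).charpoly.roots) : IsCongrOne N z := by
  classical
  obtain ⟨_, hinv, _, hcong⟩ := hγ
  haveI : Module.Finite ℤ 𝔪 := h𝔪.1
  haveI : Module.Free ℤ 𝔪 := isLattice_free h𝔪
  have hcong' : ∀ x ∈ 𝔪, ∃ y ∈ 𝔪,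
      x - vecMul x (γ : Matrix (Fin m) (Fin m) K) = (N : ℤ) • y := by
    intro x hx
    obtain ⟨y, hy, hxy⟩ := hcong x hx
    refine ⟨y, hy, ?_⟩
    rw [hxy, Nat.cast_smul_eq_nsmul, ← Nat.cast_smul_eq_nsmul ℤ]
  exact isCongrOne_of_mem_roots_charpoly_of_lattice (Module.Free.chooseBasis ℤ 𝔪) h𝔪.2 τ
    (γ : Matrix (Fin m) (Fin m) K) hinv hN hcong' hz

/-- The eigenvalues of `γ ∈ Γ_N` lie in `congrUnits N`. -/
theorem eigenvalueUnits_subset_congrUnits_of_mem_shimuraLevel (τ : K →+* ℂ)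
    (H : Matrix (Fin m) (Fin m) K) {𝔪 : Submodule ℤ (Fin m → K)} (h𝔪 : IsLattice K 𝔪)
    {N : ℕ} (hN : N ≠ 0) {γ : GL (Fin m) K} (hγ : γ ∈ shimuraLevel K H 𝔪 N) :
    eigenvalueUnits K τ γ ⊆ congrUnits N := by
  intro u hu
  have hu' : (u : ℂ) ∈ ((γ : Matrix (Fin m) (Fin m) K).map τ).charpoly.roots := hu
  -- `γ⁻¹ ∈ Γ_N`
  have hγinv : γ⁻¹ ∈ shimuraLevel K H 𝔪 N := by
    rw [← coe_shimuraLevelSubgroup] at hγ ⊢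
    exact (shimuraLevelSubgroup K H 𝔪 N).inv_mem hγ
  -- `u⁻¹` is an eigenvalue of `τ(γ⁻¹)`
  let Aunit : GL (Fin m) ℂ := Units.map (RingHom.mapMatrix τ).toMonoidHom γ
  have hAinv : ((Aunit⁻¹ : GL (Fin m) ℂ) : Matrix (Fin m) (Fin m) ℂ) =
      ((γ⁻¹ : GL (Fin m) K) : Matrix (Fin m) (Fin m) K).map τ :=
    Units.coe_map_inv (RingHom.mapMatrix τ).toMonoidHom γ
  have hu'' : (u : ℂ) ∈ (Aunit : Matrix (Fin m) (Fin m) ℂ).charpoly.roots := hu'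
  have hinv_root := inv_mem_roots_charpoly_inv Aunit hu''
  rw [hAinv] at hinv_root
  refine ⟨isCongrOne_of_mem_roots_charpoly_of_mem_shimuraLevel τ H h𝔪 hN hγ hu', ?_⟩
  rw [Units.val_inv_eq_inv_val]
  exact isCongrOne_of_mem_roots_charpoly_of_mem_shimuraLevel τ H h𝔪 hN hγinv hinv_root

/-- **Shimura's `Γ_N` is neat for `N > 2`** (DR15 Lemma 1.4 for the level group Sh79 (4.14)). -/
theorem isNeat_shimuraLevel (τ : K →+* ℂ) (H : Matrix (Fin m) (Fin m) K)
    {𝔪 : Submodule ℤ (Fin m → K)} (h𝔪 : IsLattice K 𝔪) {N : ℕ} (hN : 2 < N) :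
    IsNeat K τ (shimuraLevel K H 𝔪 N) := by
  intro γ hγ z hz n hn hpow
  have hN0 : N ≠ 0 := by omega
  have hN3 : 3 ≤ N := by omega
  have hsub : Subgroup.closure (eigenvalueUnits K τ γ) ≤ congrUnits N :=
    (Subgroup.closure_le _).mpr
      (eigenvalueUnits_subset_congrUnits_of_mem_shimuraLevel τ H h𝔪 hN0 hγ)
  exact eq_one_of_mem_congrUnits_of_pow_eq_one hN3 (hsub hz) hn hpow

/-- **Shimura's `Γ_N` is torsion-free for `N > 2`**: its arithmetic groups act freely. -/
theorem isTorsionFreeSet_shimuraLevel (τ : K →+* ℂ) (H : Matrix (Fin m) (Fin m) K)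
    {𝔪 : Submodule ℤ (Fin m → K)} (h𝔪 : IsLattice K 𝔪) {N : ℕ} (hN : 2 < N) :
    IsTorsionFreeSet K (shimuraLevel K H 𝔪 N) :=
  neatImpliesTorsionFree τ _ (isNeat_shimuraLevel τ H h𝔪 hN)

end Level

end Summit.Ventures.HodgeRepro2.ShimuraData
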